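import Mathlib
import HarnessLib

/-!
# Finite `ℤ[ω]/2^M`-modules of order `4^M` with an element of order `2^M`

Helper file of route `SylvesterTwoHeegnerIndex` (K7t), crux `UpperOffV0HSY` (item 19581), namespace
`Summit.BirchSwinnertonDyer.BirchSwinnertonDyer.Theorems.SylvesterTwoUpper.EisensteinTorsion`.  THEOREMS ONLY
(elementary module algebra; no elliptic curve appears in this file).

Let `N` be an additive commutative group and `θ : N →+ N` an additive endomorphism with
`θ(θ x) + θ x + x = 0` for all `x` — i.e. `N` is a module over the Eisenstein integers
`ℤ[ω] = ℤ[X]/(X² + X + 1)`, `ω` acting as `θ`.  The prime `2` is INERT in `ℤ[ω]`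
(`X² + X + 1` is irreducible mod `2`; equivalently the norm form `a² − ab + b²` is odd unless
`a, b` are both even, `even_and_even_of_two_dvd_norm`).  Consequences proved here, for an element
`P` of additive order `2^M`:

* `dvd_and_dvd_of_lin_eq_zero` — `a•P + b•θP = 0 ⇒ 2^M ∣ a ∧ 2^M ∣ b` (the annihilator of `P` in
  `ℤ[ω]` is `2^M ℤ[ω]`; induction on `M` through the norm identity
  `((a − b) − bθ)(a + bθ) = a² − ab + b²`, `norm_smul_eq`);
* `exists_lin_eq` — if moreover `N` is finite of order `4^M`, every `x ∈ N` is `a•P + b•θP`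
  (`N = ℤ[ω]·P ≅ ℤ[ω]/2^M` is free of rank one; counting);
* `apply_eq_lin_of_commute`, `comp_comm_of_commute` — an additive endomorphism `g` commuting with
  `θ` is `x ↦ a•x + b•θx` (`a, b` read off from `g P`), so any two such COMMUTE (the centraliser of
  `θ` is the commutative ring `ℤ[ω]/2^M`);
* `eq_zero_of_apply_eq_self_of_commute` — an INJECTIVE such `g` that moves some `2`-torsion
  element has no non-zero fixed vector (`g = a + bθ` with `b` odd, so `g − 1` has odd norm).

Use: `N = E[2^M]` for an elliptic curve `y² = x³ + D` (`j = 0`) with `θ = [ω] : (x, y) ↦ (ωx, y)`;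
the last two items are the inputs of Sah's lemma relative to `Γ_{K(ω)}` for the vanishing of
`H¹(K(E[2^M])/K, E[2^M])` (cell bsd-cm, K7t crux `UpperOffV0HSY`, first lemma).  Standard facts
about modules over the discrete valuation ring `ℤ₂[ω]`; no source is followed verbatim.
-/

set_option autoImplicit false
set_option linter.dupNamespace false

namespace Summit.BirchSwinnertonDyer.BirchSwinnertonDyer.Theorems.SylvesterTwoUpper.EisensteinTorsion

variable {N : Type*} [AddCommGroup N] (θ : N →+ N)

/-- `θ(θ x) = −θ x − x` from the Eisenstein relation. [folklore] -/
theorem apply_apply_eq (hθ : ∀ x, θ (θ x) + θ x + x = 0) (x : N) : θ (θ x) = -θ x - x := by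
  have h := hθ x
  rw [← sub_eq_zero]
  have : θ (θ x) - (-θ x - x) = θ (θ x) + θ x + x := by abel
  rw [this, h]

/-- **The norm identity** `((a − b) − bθ)·((a + bθ)x) = (a² − ab + b²)·x` in a `ℤ[ω]`-module
(`N(a + bω) = a² − ab + b²`). [folklore] -/
theorem norm_smul_eq (hθ : ∀ x, θ (θ x) + θ x + x = 0) (a b : ℤ) (x : N) :
    (a - b) • (a • x + b • θ x) - b • θ (a • x + b • θ x) = (a ^ 2 - a * b + b ^ 2) • x := by
  have h2 := apply_apply_eq θ hθ x
  simp only [map_add, map_zsmul, h2, smul_sub, smul_neg]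
  module

/-- **`2` is inert in `ℤ[ω]`**: if `2 ∣ a² − ab + b²` then `2 ∣ a` and `2 ∣ b`. [folklore] -/
theorem even_and_even_of_two_dvd_norm {a b : ℤ} (h : (2 : ℤ) ∣ a ^ 2 - a * b + b ^ 2) :
    (2 : ℤ) ∣ a ∧ (2 : ℤ) ∣ b := by
  have key : ∀ x y : ZMod 2, x ^ 2 - x * y + y ^ 2 = 0 → x = 0 ∧ y = 0 := by decide
  have h' : ((a : ZMod 2)) ^ 2 - (a : ZMod 2) * (b : ZMod 2) + (b : ZMod 2) ^ 2 = 0 := by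
    have := (ZMod.intCast_zmod_eq_zero_iff_dvd (a ^ 2 - a * b + b ^ 2) 2).mpr h
    push_cast at this
    exact this
  obtain ⟨ha, hb⟩ := key _ _ h'
  exact ⟨(ZMod.intCast_zmod_eq_zero_iff_dvd a 2).mp ha,
    (ZMod.intCast_zmod_eq_zero_iff_dvd b 2).mp hb⟩

/-- **The annihilator of an element of order `2^M` is `2^M ℤ[ω]`**: if `P` has additive order
`2^M` and `a•P + b•θP = 0`, then `2^M ∣ a` and `2^M ∣ b`.  Induction on `M`: the norm identity gives
`(a² − ab + b²)•P = 0`, so `2 ∣ a² − ab + b²`, so `a, b` are even, and `(a/2)•(2P) + (b/2)•θ(2P) = 0`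
with `2P` of order `2^{M−1}`. [folklore] -/
theorem dvd_and_dvd_of_lin_eq_zero (hθ : ∀ x, θ (θ x) + θ x + x = 0) (M : ℕ) :
    ∀ (P : N), addOrderOf P = 2 ^ M → ∀ a b : ℤ, a • P + b • θ P = 0 →
      (2 ^ M : ℤ) ∣ a ∧ (2 ^ M : ℤ) ∣ b := by
  induction M with
  | zero => intro P _ a b _; simp
  | succ M ih =>
    intro P hP a b hab
    have hn : (a ^ 2 - a * b + b ^ 2) • P = 0 := by
      rw [← norm_smul_eq θ hθ a b P, hab, map_zero, smul_zero, smul_zero, sub_zero]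
    have hdvd : ((2 ^ (M + 1) : ℕ) : ℤ) ∣ a ^ 2 - a * b + b ^ 2 := by
      rw [← hP]
      exact addOrderOf_dvd_iff_zsmul_eq_zero.mpr hn
    have hdvd' : (2 : ℤ) ^ (M + 1) ∣ a ^ 2 - a * b + b ^ 2 := by exact_mod_cast hdvd
    have h2 : (2 : ℤ) ∣ a ^ 2 - a * b + b ^ 2 :=
      (dvd_pow_self (2 : ℤ) (Nat.succ_ne_zero M)).trans hdvd'
    obtain ⟨⟨a₁, rfl⟩, ⟨b₁, rfl⟩⟩ := even_and_even_of_two_dvd_norm h2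
    have hP2 : addOrderOf ((2 : ℕ) • P) = 2 ^ M := by
      rw [addOrderOf_nsmul_of_dvd two_ne_zero (by rw [hP]; exact dvd_pow_self 2 (Nat.succ_ne_zero M)),
        hP, pow_succ, Nat.mul_div_cancel _ two_pos]
    have hab2 : a₁ • ((2 : ℕ) • P) + b₁ • θ ((2 : ℕ) • P) = 0 := by
      rw [← hab, map_nsmul]
      module
    obtain ⟨ha, hb⟩ := ih _ hP2 a₁ b₁ hab2
    have e : ((2 : ℤ) ^ (M + 1)) = 2 * 2 ^ M := by ring
    rw [e]
    exact ⟨mul_dvd_mul_left 2 ha, mul_dvd_mul_left 2 hb⟩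

section Finite

variable [Finite N] (hθ : ∀ x, θ (θ x) + θ x + x = 0) {M : ℕ} (hcard : Nat.card N = 4 ^ M)
  {P : N} (hP : addOrderOf P = 2 ^ M)
include hθ hcard hP

/-- **`N = ℤ[ω]·P`**: if `N` is finite of order `4^M` and `P` has order `2^M`, every element of `N`
is `a•P + b•θP` (the map `(a, b) ↦ a•P + b•θP` on `(ℤ/2^M)²` is injective by
`dvd_and_dvd_of_lin_eq_zero`, hence bijective by counting). [folklore] -/
theorem exists_lin_eq (x : N) : ∃ a b : ℤ, x = a • P + b • θ P := by
  haveI : NeZero (2 ^ M) := ⟨pow_ne_zero _ two_ne_zero⟩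
  let f : ZMod (2 ^ M) × ZMod (2 ^ M) → N := fun uv =>
    (uv.1.val : ℤ) • P + (uv.2.val : ℤ) • θ P
  have hinj : Function.Injective f := by
    rintro ⟨u, v⟩ ⟨u', v'⟩ h
    have h0 : ((u.val : ℤ) - u'.val) • P + ((v.val : ℤ) - v'.val) • θ P = 0 := by
      have h' : (u.val : ℤ) • P + (v.val : ℤ) • θ P = (u'.val : ℤ) • P + (v'.val : ℤ) • θ P := h
      rw [sub_smul, sub_smul, ← sub_eq_zero.mpr h']
      abel
    obtain ⟨hu, hv⟩ := dvd_and_dvd_of_lin_eq_zero θ hθ M P hP _ _ h0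
    have hu' : (u.val : ZMod (2 ^ M)) = (u'.val : ZMod (2 ^ M)) := by
      have := (ZMod.intCast_zmod_eq_zero_iff_dvd ((u.val : ℤ) - u'.val) (2 ^ M)).mpr
        (by exact_mod_cast hu)
      push_cast at this
      exact sub_eq_zero.mp this
    have hv' : (v.val : ZMod (2 ^ M)) = (v'.val : ZMod (2 ^ M)) := by
      have := (ZMod.intCast_zmod_eq_zero_iff_dvd ((v.val : ℤ) - v'.val) (2 ^ M)).mpr
        (by exact_mod_cast hv)
      push_cast at this
      exact sub_eq_zero.mp this
    rw [ZMod.natCast_zmod_val, ZMod.natCast_zmod_val] at hu' hv'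
    rw [hu', hv']
  have hc : Nat.card (ZMod (2 ^ M) × ZMod (2 ^ M)) = Nat.card N := by
    rw [Nat.card_prod, Nat.card_zmod, hcard, ← pow_two, ← pow_mul, pow_mul']
    norm_num
  have hbij : Function.Bijective f := (Nat.bijective_iff_injective_and_card f).mpr ⟨hinj, hc⟩
  obtain ⟨⟨u, v⟩, rfl⟩ := hbij.2 x
  exact ⟨u.val, v.val, rfl⟩

/-- **An endomorphism commuting with `θ` is `a + bθ`**: if `g ∘ θ = θ ∘ g` and
`g P = a•P + b•θP`, then `g x = a•x + b•θx` for every `x` (check on `x = c•P + d•θP`). [folklore] -/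
theorem apply_eq_lin_of_commute (g : N →+ N) (hg : ∀ x, g (θ x) = θ (g x)) {a b : ℤ}
    (hgP : g P = a • P + b • θ P) (x : N) : g x = a • x + b • θ x := by
  obtain ⟨c, d, rfl⟩ := exists_lin_eq θ hθ hcard hP x
  have h2 := apply_apply_eq θ hθ P
  simp only [map_add, map_zsmul, hg, hgP, h2, smul_add, smul_sub, smul_neg]
  module

/-- **The centraliser of `θ` is commutative**: two additive endomorphisms commuting with `θ`
commute with each other (both are of the form `a + bθ`). [folklore] -/
theorem comp_comm_of_commute (g₁ g₂ : N →+ N) (hg₁ : ∀ x, g₁ (θ x) = θ (g₁ x))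
    (hg₂ : ∀ x, g₂ (θ x) = θ (g₂ x)) (x : N) : g₁ (g₂ x) = g₂ (g₁ x) := by
  obtain ⟨a₁, b₁, h₁⟩ := exists_lin_eq θ hθ hcard hP (g₁ P)
  obtain ⟨a₂, b₂, h₂⟩ := exists_lin_eq θ hθ hcard hP (g₂ P)
  have e₁ := apply_eq_lin_of_commute θ hθ hcard hP g₁ hg₁ h₁
  have e₂ := apply_eq_lin_of_commute θ hθ hcard hP g₂ hg₂ h₂
  have h2 := apply_apply_eq θ hθ x
  rw [e₂ x, e₁ x, e₁, e₂]
  simp only [map_add, map_zsmul, h2, smul_add, smul_sub, smul_neg]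
  module

/-- **No fixed vector**: let `M ≥ 1`, `g` an INJECTIVE additive endomorphism commuting with `θ`
which moves some `2`-torsion element `t`.  Then `g x = x` forces `x = 0`.  Indeed `g = a + bθ`; if `b`
were even then `a` is odd (else `g` kills `2^{M−1}P ≠ 0`) and `g t = t`; so `b` is odd, and
`g x = x` reads `((a−1) + bθ)x = 0`, whence `n•x = 0` with `n = (a−1)² − (a−1)b + b²` odd, while the
order of `x` is a power of `2`. [folklore] -/
theorem eq_zero_of_apply_eq_self_of_commute (hM : 1 ≤ M) (g : N →+ N)
    (hg : ∀ x, g (θ x) = θ (g x)) (hinj : Function.Injective g) {t : N} (h2t : (2 : ℕ) • t = 0)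
    (hgt : g t ≠ t) {x : N} (hx : g x = x) : x = 0 := by
  obtain ⟨a, b, hgP⟩ := exists_lin_eq θ hθ hcard hP (g P)
  have hlin := apply_eq_lin_of_commute θ hθ hcard hP g hg hgP
  -- `b` is odd
  have hb : ¬ (2 : ℤ) ∣ b := by
    rintro ⟨b₁, rfl⟩
    have ha : ¬ (2 : ℤ) ∣ a := by
      rintro ⟨a₁, rfl⟩
      -- `g (2^(M-1) • P) = 0` but `2^(M-1) • P ≠ 0`
      have hne : (2 ^ (M - 1) : ℕ) • P ≠ 0 :=
        nsmul_ne_zero_of_lt_addOrderOf (pow_ne_zero _ two_ne_zero)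
          (by rw [hP]; exact Nat.pow_lt_pow_right (by norm_num) (by omega))
      apply hne
      apply hinj
      rw [map_zero, map_nsmul, hgP]
      have hMP : ((2 ^ M : ℕ) : ℤ) • P = 0 := by
        rw [← hP]; exact_mod_cast addOrderOf_nsmul_eq_zero P
      have e : (2 ^ (M - 1) : ℕ) • ((2 * a₁) • P + (2 * b₁) • θ P) =
          a₁ • (((2 ^ M : ℕ) : ℤ) • P) + b₁ • θ (((2 ^ M : ℕ) : ℤ) • P) := by
        obtain ⟨k, hk⟩ : ∃ k, M = k + 1 := ⟨M - 1, by omega⟩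
        subst hk
        rw [Nat.add_sub_cancel, map_zsmul]
        push_cast
        rw [pow_succ]
        module
      rw [e, hMP, map_zero, smul_zero, smul_zero, add_zero]
    obtain ⟨a₁, ha₁⟩ := Int.even_or_odd' a
    rcases ha₁ with rfl | rfl
    · exact ha ⟨a₁, rfl⟩
    apply hgt
    rw [hlin t]
    have h2t' : (2 : ℤ) • t = 0 := by exact_mod_cast h2t
    have e : (2 * a₁ + 1) • t + (2 * b₁) • θ t = a₁ • ((2 : ℤ) • t) + t + b₁ • θ ((2 : ℤ) • t) := by
      rw [map_zsmul]; module
    rw [e, h2t', map_zero, smul_zero, smul_zero, zero_add, add_zero]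
  -- `((a - 1) + bθ) x = 0`
  have h0 : (a - 1) • x + b • θ x = 0 := by
    have := hlin x
    rw [hx] at this
    rw [sub_smul, one_smul, ← sub_eq_zero.mpr this.symm]
    abel
  have hn : ((a - 1) ^ 2 - (a - 1) * b + b ^ 2) • x = 0 := by
    rw [← norm_smul_eq θ hθ (a - 1) b x, h0, map_zero, smul_zero, smul_zero, sub_zero]
  have hnodd : ¬ (2 : ℤ) ∣ (a - 1) ^ 2 - (a - 1) * b + b ^ 2 := fun h =>
    hb (even_and_even_of_two_dvd_norm h).2
  -- the order of `x` divides the odd number `n` and the power of two `Nat.card N`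
  have hord2 : addOrderOf x ∣ 2 ^ (2 * M) := by
    have := addOrderOf_dvd_natCard x
    rwa [hcard, show (4 : ℕ) = 2 ^ 2 by norm_num, ← pow_mul] at this
  obtain ⟨j, hjle, hj⟩ := (Nat.dvd_prime_pow Nat.prime_two).mp hord2
  have hordn : (addOrderOf x : ℤ) ∣ (a - 1) ^ 2 - (a - 1) * b + b ^ 2 :=
    addOrderOf_dvd_iff_zsmul_eq_zero.mpr hn
  rcases j with _ | j
  · rw [pow_zero] at hj
    exact AddMonoid.addOrderOf_eq_one_iff.mp hj
  · exfalso
    apply hnodd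
    rw [hj] at hordn
    push_cast at hordn
    exact (dvd_pow_self (2 : ℤ) (Nat.succ_ne_zero j)).trans hordn

end Finite

end Summit.BirchSwinnertonDyer.BirchSwinnertonDyer.Theorems.SylvesterTwoUpper.EisensteinTorsion
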